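import Summits.KontsevichZagierPeriods.Zeta5Search.TwoTaleOmega.OmegaBaseValues
import Summits.KontsevichZagierPeriods.Zeta5Search.TwoTaleOmega.OmegaPlug5
import Summits.KontsevichZagierPeriods.Zeta5Search.TwoTaleOmega.StepA

/-!
# (bmiss)@Ω — the CLOSURE: cert-2's Ω-induction assembled, modulo the `aef` step relations (cell `pub-zeta5`, cert-2 gen 5)

HONEST FRAMING: systematic search; recurrence certificates; no irrationality claim unless certified. Finite algebra over `ℚ`; no named
fact, no `sorry`.

`TwoTaleOmegaRuleLegit.eq_on_Omega_rule` (cert-2 g4: fam-tele's Ω-induction of `certs/tele/bmiss_general/PROOF.md` §1 with the kernel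
coefficient tables, (S3), rule analysis and coverage) is INSTANTIATED here with `Cert := CertU` (every rule step certified), `I_L := U1 ∘ ofVec`
(resp. `U0 ∘ ofVec`) and `I_R := 0`:
* `hbase` = `OmegaBaseValues.U_zero_of_base` (the 1908-point table, cert-2 g4's BaseQ/BaseP + gen 5's enumeration and odd points);
* `hL` for `δ ∈ {b, e, f, g, bg}` = cert-1 g4's `OmegaPlug5.hstep5_U1/U0`; for `δ = a` = cert-1 g4's `StepA.hstepA_U1/U0`, whose legitimacy clause
  `b + 4 ≤ g` at the base point is AUTOMATIC on the a-rule domain (`hLeg_dirA`: target in `RuleDom a` with `a ≥ 17` ⇒ `g − b ≥ (a−3)/2 ≥ 7` by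
  `TwoTaleOmegaRules.gb_bounds`) — this answers cert-1's 13:46Z `g = b+3` question for the induction as architected;
* `hL` for `δ = aef` is kept as the HYPOTHESIS `haef` (the 81 one-parameter families; the tree has their telescoping identities
  `TwoTaleTelescopeAef*` and (S3) `cAEFtab_three_ne_zero`, not yet the analytic step);
* `hR` is trivial for `I_R = 0`.
Results: `U_zero_on_Omega_of_aef` — `haef → ∀ q ∈ Ω, U1 = U0 = 0`; `bmiss_on_Omega_of_aef` — hence Zudilin's (bmiss) (`OmegaForms.Bmiss`, via
`bmiss_iff`) at every point of Ω with `d ≥ 0`; `hP_of_aef` — hence the hypothesis `hP` of `TwoTaleP15Endgame` along P15 (`OmegaForms.hP_of_U`).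
-/

noncomputable section

open Finset
open Literature.NumberTheory.Irrationality.Zudilin2014
open Summit.KontsevichZagierPeriods.Zeta5Search.FormalBarnes
open Summit.KontsevichZagierPeriods.Zeta5Search.Certificates.TwoTaleTelescope

namespace Summit.KontsevichZagierPeriods.Zeta5Search.TwoTaleOmega

/-! The remaining analytic input, kept as the hypothesis `haef` below: the `aef` step relations of BOTH hinge forms at every certified aef
rule step (base point `p₀`, telescoper `coef cAEFtab dirAEF p₀ k = cAEFtab p₀ k`, the shape table of `TwoTaleOmegaAefTable`):
`∀ p₀ ∈ StepBase (LegitSet CertU) dirAEF, (Σ_{k<4} cAEFtab p₀ k · U1(p₀ + k·aef) = 0) ∧ (Σ_{k<4} cAEFtab p₀ k · U0(p₀ + k·aef) = 0)`. -/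

/-- **The legitimacy clause of direction `a` is automatic on the rule domain**: a certified a-rule step (target in `RuleDom a`, `a ≥ 17` at the
target) has `b + 4 ≤ g` at its base point. -/
theorem hLeg_dirA (p₀ : Certificates.TwoTaleTelescope.Pt) (h : p₀ ∈ LegitSet CertU dirA) : p₀ 1 + 4 ≤ p₀ 4 := by
  obtain ⟨hr, -, h17⟩ := h
  have h17' := h17 (Or.inl rfl)
  rw [ruleDom_A] at hr
  obtain ⟨hA, hg, hb, -, -⟩ := hr
  have hΩ : p₀ + (3 : ℤ) • dirA ∈ Omega := by simpa using hA 0 (by norm_num)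
  have hgb := gb_bounds _ hΩ h17' hg hb
  rw [mem_Omega] at hΩ
  have e0 : (p₀ + (3 : ℤ) • dirA) 0 = p₀ 0 + 3 := by simp [dirA]
  have e1 : (p₀ + (3 : ℤ) • dirA) 1 = p₀ 1 := by simp [dirA]
  have e2 : (p₀ + (3 : ℤ) • dirA) 2 = p₀ 2 := by simp [dirA]
  have e3 : (p₀ + (3 : ℤ) • dirA) 3 = p₀ 3 := by simp [dirA]
  have e4 : (p₀ + (3 : ℤ) • dirA) 4 = p₀ 4 := by simp [dirA]
  rw [e0, e1, e2, e3, e4] at hΩ hgb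
  rw [e0] at h17'
  omega

/-- The step hypotheses `hL` of `eq_on_Omega_rule` for `U1`, all seven directions (aef from the hypothesis `haef`). -/
theorem hL_U1 (haef : ∀ p₀ ∈ StepBase (fun δ p₀ => p₀ ∈ LegitSet CertU δ) dirAEF,
      (∑ k ∈ range 4, (coef cAEFtab dirAEF p₀ k : ℚ) * (ofVec (p₀ + (k : ℤ) • dirAEF)).U1 = 0) ∧
      (∑ k ∈ range 4, (coef cAEFtab dirAEF p₀ k : ℚ) * (ofVec (p₀ + (k : ℤ) • dirAEF)).U0 = 0)) : ∀ δ, ∀ p₀ ∈ StepBase (fun δ p₀ => p₀ ∈ LegitSet CertU δ) δ,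
    ∑ k ∈ range 4, (coef cAEFtab δ p₀ k : ℚ) * (ofVec (p₀ + (k : ℤ) • δ)).U1 = 0 := by
  intro δ p₀ h
  have hδ := h.1
  simp only [dirs, List.mem_cons, List.mem_nil_iff, or_false] at hδ
  rcases hδ with rfl | rfl | rfl | rfl | rfl | rfl | rfl
  · exact hstep5_U1 cAEFtab _ (Or.inr (Or.inr (Or.inr (Or.inl rfl)))) p₀ h
  · exact hstep5_U1 cAEFtab _ (Or.inl rfl) p₀ h
  · exact hstep5_U1 cAEFtab _ (Or.inr (Or.inl rfl)) p₀ h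
  · exact hstep5_U1 cAEFtab _ (Or.inr (Or.inr (Or.inl rfl))) p₀ h
  · exact hstepA_U1 cAEFtab _ hLeg_dirA p₀ h
  · exact (haef p₀ h).1
  · exact hstep5_U1 cAEFtab _ (Or.inr (Or.inr (Or.inr (Or.inr rfl)))) p₀ h

/-- The step hypotheses `hL` of `eq_on_Omega_rule` for `U0`, all seven directions (aef from the hypothesis `haef`). -/
theorem hL_U0 (haef : ∀ p₀ ∈ StepBase (fun δ p₀ => p₀ ∈ LegitSet CertU δ) dirAEF,
      (∑ k ∈ range 4, (coef cAEFtab dirAEF p₀ k : ℚ) * (ofVec (p₀ + (k : ℤ) • dirAEF)).U1 = 0) ∧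
      (∑ k ∈ range 4, (coef cAEFtab dirAEF p₀ k : ℚ) * (ofVec (p₀ + (k : ℤ) • dirAEF)).U0 = 0)) : ∀ δ, ∀ p₀ ∈ StepBase (fun δ p₀ => p₀ ∈ LegitSet CertU δ) δ,
    ∑ k ∈ range 4, (coef cAEFtab δ p₀ k : ℚ) * (ofVec (p₀ + (k : ℤ) • δ)).U0 = 0 := by
  intro δ p₀ h
  have hδ := h.1
  simp only [dirs, List.mem_cons, List.mem_nil_iff, or_false] at hδ
  rcases hδ with rfl | rfl | rfl | rfl | rfl | rfl | rfl
  · exact hstep5_U0 cAEFtab _ (Or.inr (Or.inr (Or.inr (Or.inl rfl)))) p₀ h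
  · exact hstep5_U0 cAEFtab _ (Or.inl rfl) p₀ h
  · exact hstep5_U0 cAEFtab _ (Or.inr (Or.inl rfl)) p₀ h
  · exact hstep5_U0 cAEFtab _ (Or.inr (Or.inr (Or.inl rfl))) p₀ h
  · exact hstepA_U0 cAEFtab _ hLeg_dirA p₀ h
  · exact (haef p₀ h).2
  · exact hstep5_U0 cAEFtab _ (Or.inr (Or.inr (Or.inr (Or.inr rfl)))) p₀ h

/-- **(bmiss)@Ω modulo the aef steps, functional form**: aef steps `→ ∀ q ∈ Ω, U1(q) = 0 ∧ U0(q) = 0`. -/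
theorem U_zero_on_Omega_of_aef (haef : ∀ p₀ ∈ StepBase (fun δ p₀ => p₀ ∈ LegitSet CertU δ) dirAEF,
      (∑ k ∈ range 4, (coef cAEFtab dirAEF p₀ k : ℚ) * (ofVec (p₀ + (k : ℤ) • dirAEF)).U1 = 0) ∧
      (∑ k ∈ range 4, (coef cAEFtab dirAEF p₀ k : ℚ) * (ofVec (p₀ + (k : ℤ) • dirAEF)).U0 = 0)) :
    ∀ q ∈ Certificates.TwoTaleTelescope.Omega, (ofVec q).U1 = 0 ∧ (ofVec q).U0 = 0 := by
  intro q hq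
  have triv : ∀ δ, ∀ p₀ ∈ StepBase (fun δ p₀ => p₀ ∈ LegitSet CertU δ) δ,
      ∑ k ∈ range 4, (coef cAEFtab δ p₀ k : ℚ) * (fun _ : Certificates.TwoTaleTelescope.Pt => (0 : ℚ)) (p₀ + (k : ℤ) • δ) = 0 :=
    fun δ p₀ _ => by simp
  refine ⟨?_, ?_⟩
  · exact eq_on_Omega_rule CertU (fun q => (ofVec q).U1) (fun _ => 0) (fun p hp => (U_zero_of_base hp).1) (hL_U1 haef) triv q hq
  · exact eq_on_Omega_rule CertU (fun q => (ofVec q).U0) (fun _ => 0) (fun p hp => (U_zero_of_base hp).2) (hL_U0 haef) triv q hq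

/-- The vector of a point. -/
def toVec (p : Pt) : Certificates.TwoTaleTelescope.Pt := ![p.a, p.b, p.e, p.f, p.g]

/-- `ofVec (toVec p) = p`. -/
@[simp] theorem ofVec_toVec (p : Pt) : ofVec (toVec p) = p := by
  cases p; simp [ofVec, toVec]

/-- **(bmiss)@Ω modulo the aef steps**: for every `p ∈ Ω` with `d(p) ≥ 0`, Zudilin's two-tale identity `Bmiss p`
(`formQ = −formQT ∧ formP = −formPT` at the tale data of `p`). -/
theorem bmiss_on_Omega_of_aef (haef : ∀ p₀ ∈ StepBase (fun δ p₀ => p₀ ∈ LegitSet CertU δ) dirAEF,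
      (∑ k ∈ range 4, (coef cAEFtab dirAEF p₀ k : ℚ) * (ofVec (p₀ + (k : ℤ) • dirAEF)).U1 = 0) ∧
      (∑ k ∈ range 4, (coef cAEFtab dirAEF p₀ k : ℚ) * (ofVec (p₀ + (k : ℤ) • dirAEF)).U0 = 0)) (p : Pt) (hp : p.Omega) (hd : 0 ≤ p.dInt) : p.Bmiss := by
  have hq : toVec p ∈ Certificates.TwoTaleTelescope.Omega := mem_Omega_ofVec (by rw [ofVec_toVec]; exact hp)
  have h := U_zero_on_Omega_of_aef haef (toVec p) hq
  rw [ofVec_toVec] at h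
  exact (p.bmiss_iff hd).2 h

/-- The points `Pt.P15 n`, `n ≥ 1`, lie in Ω. -/
theorem P15_Omega (n : ℕ) (hn : 1 ≤ n) : (Pt.P15 n).Omega := by
  have hn' : (1 : ℤ) ≤ n := by exact_mod_cast hn
  refine ⟨?_, ?_, ?_, ?_, ?_, ?_, ?_, ?_, ?_⟩ <;> simp only [Pt.P15] <;> omega

/-- **`hP` of `TwoTaleP15Endgame` modulo the aef steps**: aef steps `→ ∀ n ≥ 1, formP(aP15 n, bP15 n) = −formPT(aT n, bT n)`. -/
theorem hP_of_aef (haef : ∀ p₀ ∈ StepBase (fun δ p₀ => p₀ ∈ LegitSet CertU δ) dirAEF,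
      (∑ k ∈ range 4, (coef cAEFtab dirAEF p₀ k : ℚ) * (ofVec (p₀ + (k : ℤ) • dirAEF)).U1 = 0) ∧
      (∑ k ∈ range 4, (coef cAEFtab dirAEF p₀ k : ℚ) * (ofVec (p₀ + (k : ℤ) • dirAEF)).U0 = 0)) :
    ∀ n : ℕ, 1 ≤ n → formP (TwoTaleP15.aP15 n) (TwoTaleP15.bP15 n) = -formPT (TwoTaleP15.aT n) (TwoTaleP15.bT n) :=
  Pt.hP_of_U fun n hn => by
    have hq : toVec (Pt.P15 n) ∈ Certificates.TwoTaleTelescope.Omega :=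
      mem_Omega_ofVec (by rw [ofVec_toVec]; exact P15_Omega n hn)
    have h := U_zero_on_Omega_of_aef haef (toVec (Pt.P15 n)) hq
    rwa [ofVec_toVec] at h

end Summit.KontsevichZagierPeriods.Zeta5Search.TwoTaleOmega

end
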